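import Summits.ValiantsHypothesis.ValiantsHypothesis.Theorems.LacunarySymmetroidMatrixDescartesDoorA26WallBubblingChainCeilingTight

/-!
# Wall bubbling for `DoorA26` — THREE WEYL PAIRS (value-generic): THE MEMBER DICTIONARY

HONEST FRAMING.  Bookkeeping for `ValueGenericThreePairChain26` of `Cruxes/DoorA26/Lines/wall_bubbling_ConfluentDoor.lean` (rev 7 ff.;
crux `DoorA26`, stmt-ValiantsHypothesis-19979 — OPEN, typed, never asserted); W1 seat val-sym-door-p2 g14.  The three-pair analogue of W1 g13's
#52a/#52b `…TwoPairChainDictionary(B)`: at a point with `δ0 5 = δ0 0`, `δ0 4 = δ0 1`, `δ0 3 = δ0 2` and VALUE-GENERIC values (`hvg`: a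
coincidence of pair sums of `δ0 0, δ0 1, δ0 2` is a coincidence of the pairs), a member `(p,q)` of a class value with confluent degree
(`1` at positions `3,4,5`) equal to `2` resp. `1` is one of the canonical slots of that class:

* pure class `2δ_a` (`a = 0,1,2`, positions `{a, 5−a}`): degree 2 ⇒ `(5−a, 5−a)`; degree 1 ⇒ `(a, 5−a)` (up to symmetry);
* mixed class `δ_a+δ_b` (`a < b`): degree 2 ⇒ `(5−a, 5−b)`; degree 1 ⇒ `(a, 5−b)` or `(5−a, b)` (up to symmetry).

Stated for an arbitrary symmetric relation `A` on positions (the alive relation of a cluster).  Pure finite bookkeeping; def-free; nothing here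
bears on `DoorA26`, `MatrixDescartes` (stmt-ValiantsHypothesis-18050) or `VP ≠ VNP`.  `--supports stmt-ValiantsHypothesis-19979 --as helper`.
-/

-- `Summit.ValiantsHypothesis.ValiantsHypothesis.…` repeats a component by the D-0017 layout
-- (single-conjunct summit), which the `dupNamespace` linter flags; the name is mandated.
set_option linter.dupNamespace false

namespace Summit.ValiantsHypothesis.ValiantsHypothesis.Theorems.LacunarySymmetroidMatrixDescartes.WallBubbling

open Finset
open scoped BigOperators

/-- The class of each of the six positions at a three-Weyl-pair point (`{0,5} ↦ 0`, `{1,4} ↦ 1`, `{2,3} ↦ 2`). [this work] -/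
theorem threePair_classes (δ0 : Fin 6 → ℝ) (h50 : δ0 5 = δ0 0) (h41 : δ0 4 = δ0 1) (h32 : δ0 3 = δ0 2) :
    ∀ p : Fin 6, ∃ a : Fin 3, δ0 p = δ0 a.castSucc.castSucc.castSucc ∧
      (a = 0 ↔ (p = 0 ∨ p = 5)) ∧ (a = 1 ↔ (p = 1 ∨ p = 4)) ∧ (a = 2 ↔ (p = 2 ∨ p = 3)) := by
  intro p
  fin_cases p
  · exact ⟨0, rfl, by decide, by decide, by decide⟩
  · exact ⟨1, rfl, by decide, by decide, by decide⟩
  · exact ⟨2, rfl, by decide, by decide, by decide⟩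
  · exact ⟨2, h32, by decide, by decide, by decide⟩
  · exact ⟨1, h41, by decide, by decide, by decide⟩
  · exact ⟨0, h50, by decide, by decide, by decide⟩

/-- The value-generic coincidence pattern `hvg` read on members: the classes of a member of a given class value. [this work] -/
theorem threePair_member_classes (δ0 : Fin 6 → ℝ) (h50 : δ0 5 = δ0 0) (h41 : δ0 4 = δ0 1) (h32 : δ0 3 = δ0 2)
    (hvg : ∀ a b c e : Fin 3, δ0 a.castSucc.castSucc.castSucc + δ0 b.castSucc.castSucc.castSucc
        = δ0 c.castSucc.castSucc.castSucc + δ0 e.castSucc.castSucc.castSucc → (a = c ∧ b = e) ∨ (a = e ∧ b = c)) :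
    ∀ p q : Fin 6, ∀ a₀ b₀ : Fin 3, δ0 p + δ0 q = δ0 a₀.castSucc.castSucc.castSucc + δ0 b₀.castSucc.castSucc.castSucc →
      ∃ a b : Fin 3, ((a = 0 ↔ (p = 0 ∨ p = 5)) ∧ (a = 1 ↔ (p = 1 ∨ p = 4)) ∧ (a = 2 ↔ (p = 2 ∨ p = 3))) ∧
        ((b = 0 ↔ (q = 0 ∨ q = 5)) ∧ (b = 1 ↔ (q = 1 ∨ q = 4)) ∧ (b = 2 ↔ (q = 2 ∨ q = 3))) ∧
        ((a = a₀ ∧ b = b₀) ∨ (a = b₀ ∧ b = a₀)) := by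
  intro p q a₀ b₀ h
  obtain ⟨a, ha, hca⟩ := threePair_classes δ0 h50 h41 h32 p
  obtain ⟨b, hb, hcb⟩ := threePair_classes δ0 h50 h41 h32 q
  exact ⟨a, b, hca, hcb, hvg a b a₀ b₀ (by rw [← ha, ← hb]; exact h)⟩

/-- The confluent degree of a position at three pairs: `1` at `3, 4, 5`. [this work] -/
theorem threePair_deg (p : Fin 6) :
    (if p = 5 then 1 else if p = 4 then 1 else if p = 3 then 1 else 0) = (if (p = 3 ∨ p = 4 ∨ p = 5) then 1 else 0) := by
  fin_cases p <;> simp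

/-- Pure class `2δ₀`: a degree-2 member alive ⇒ the `t²`-slot `(5,5)` is alive. [this work] -/
theorem threePair_dict_P0_2 (δ0 : Fin 6 → ℝ) (h50 : δ0 5 = δ0 0) (h41 : δ0 4 = δ0 1) (h32 : δ0 3 = δ0 2)
    (hvg : ∀ a b c e : Fin 3, δ0 a.castSucc.castSucc.castSucc + δ0 b.castSucc.castSucc.castSucc
        = δ0 c.castSucc.castSucc.castSucc + δ0 e.castSucc.castSucc.castSucc → (a = c ∧ b = e) ∨ (a = e ∧ b = c))
    (A : Fin 6 → Fin 6 → Prop) (_hAs : ∀ p q, A p q → A q p) :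
    ∀ p q : Fin 6, δ0 p + δ0 q = δ0 0 + δ0 0 → A p q →
      (if p = 5 then 1 else if p = 4 then 1 else if p = 3 then 1 else 0) + (if q = 5 then 1 else if q = 4 then 1 else if q = 3 then 1 else 0) = 2 → A 5 5 := by
  intro p q hpq hpol hdg
  obtain ⟨a, b, hca, hcb, hdisj⟩ := threePair_member_classes δ0 h50 h41 h32 hvg p q 0 0 hpq
  rw [threePair_deg, threePair_deg] at hdg
  rcases hdisj with ⟨ha, hb⟩ | ⟨ha, hb⟩
  · rcases hca.1.mp ha with rfl | rfl
    · rcases hcb.1.mp hb with rfl | rfl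
      · simp at hdg
      · simp at hdg
    · rcases hcb.1.mp hb with rfl | rfl
      · simp at hdg
      · exact hpol
  · rcases hca.1.mp ha with rfl | rfl
    · rcases hcb.1.mp hb with rfl | rfl
      · simp at hdg
      · simp at hdg
    · rcases hcb.1.mp hb with rfl | rfl
      · simp at hdg
      · exact hpol

/-- Pure class `2δ₀`: a degree-1 member alive ⇒ the `t`-slot `(0,5)` is alive. [this work] -/
theorem threePair_dict_P0_1 (δ0 : Fin 6 → ℝ) (h50 : δ0 5 = δ0 0) (h41 : δ0 4 = δ0 1) (h32 : δ0 3 = δ0 2)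
    (hvg : ∀ a b c e : Fin 3, δ0 a.castSucc.castSucc.castSucc + δ0 b.castSucc.castSucc.castSucc
        = δ0 c.castSucc.castSucc.castSucc + δ0 e.castSucc.castSucc.castSucc → (a = c ∧ b = e) ∨ (a = e ∧ b = c))
    (A : Fin 6 → Fin 6 → Prop) (hAs : ∀ p q, A p q → A q p) :
    ∀ p q : Fin 6, δ0 p + δ0 q = δ0 0 + δ0 0 → A p q →
      (if p = 5 then 1 else if p = 4 then 1 else if p = 3 then 1 else 0) + (if q = 5 then 1 else if q = 4 then 1 else if q = 3 then 1 else 0) = 1 → A 0 5 := by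
  intro p q hpq hpol hdg
  obtain ⟨a, b, hca, hcb, hdisj⟩ := threePair_member_classes δ0 h50 h41 h32 hvg p q 0 0 hpq
  rw [threePair_deg, threePair_deg] at hdg
  rcases hdisj with ⟨ha, hb⟩ | ⟨ha, hb⟩
  · rcases hca.1.mp ha with rfl | rfl
    · rcases hcb.1.mp hb with rfl | rfl
      · simp at hdg
      · exact hpol
    · rcases hcb.1.mp hb with rfl | rfl
      · exact hAs _ _ hpol
      · simp at hdg
  · rcases hca.1.mp ha with rfl | rfl
    · rcases hcb.1.mp hb with rfl | rfl
      · simp at hdg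
      · exact hpol
    · rcases hcb.1.mp hb with rfl | rfl
      · exact hAs _ _ hpol
      · simp at hdg

/-- Pure class `2δ₁`: a degree-2 member alive ⇒ the `t²`-slot `(4,4)` is alive. [this work] -/
theorem threePair_dict_P1_2 (δ0 : Fin 6 → ℝ) (h50 : δ0 5 = δ0 0) (h41 : δ0 4 = δ0 1) (h32 : δ0 3 = δ0 2)
    (hvg : ∀ a b c e : Fin 3, δ0 a.castSucc.castSucc.castSucc + δ0 b.castSucc.castSucc.castSucc
        = δ0 c.castSucc.castSucc.castSucc + δ0 e.castSucc.castSucc.castSucc → (a = c ∧ b = e) ∨ (a = e ∧ b = c))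
    (A : Fin 6 → Fin 6 → Prop) (_hAs : ∀ p q, A p q → A q p) :
    ∀ p q : Fin 6, δ0 p + δ0 q = δ0 1 + δ0 1 → A p q →
      (if p = 5 then 1 else if p = 4 then 1 else if p = 3 then 1 else 0) + (if q = 5 then 1 else if q = 4 then 1 else if q = 3 then 1 else 0) = 2 → A 4 4 := by
  intro p q hpq hpol hdg
  obtain ⟨a, b, hca, hcb, hdisj⟩ := threePair_member_classes δ0 h50 h41 h32 hvg p q 1 1 hpq
  rw [threePair_deg, threePair_deg] at hdg
  rcases hdisj with ⟨ha, hb⟩ | ⟨ha, hb⟩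
  · rcases hca.2.1.mp ha with rfl | rfl
    · rcases hcb.2.1.mp hb with rfl | rfl
      · simp at hdg
      · simp at hdg
    · rcases hcb.2.1.mp hb with rfl | rfl
      · simp at hdg
      · exact hpol
  · rcases hca.2.1.mp ha with rfl | rfl
    · rcases hcb.2.1.mp hb with rfl | rfl
      · simp at hdg
      · simp at hdg
    · rcases hcb.2.1.mp hb with rfl | rfl
      · simp at hdg
      · exact hpol

/-- Pure class `2δ₁`: a degree-1 member alive ⇒ the `t`-slot `(1,4)` is alive. [this work] -/
theorem threePair_dict_P1_1 (δ0 : Fin 6 → ℝ) (h50 : δ0 5 = δ0 0) (h41 : δ0 4 = δ0 1) (h32 : δ0 3 = δ0 2)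
    (hvg : ∀ a b c e : Fin 3, δ0 a.castSucc.castSucc.castSucc + δ0 b.castSucc.castSucc.castSucc
        = δ0 c.castSucc.castSucc.castSucc + δ0 e.castSucc.castSucc.castSucc → (a = c ∧ b = e) ∨ (a = e ∧ b = c))
    (A : Fin 6 → Fin 6 → Prop) (hAs : ∀ p q, A p q → A q p) :
    ∀ p q : Fin 6, δ0 p + δ0 q = δ0 1 + δ0 1 → A p q →
      (if p = 5 then 1 else if p = 4 then 1 else if p = 3 then 1 else 0) + (if q = 5 then 1 else if q = 4 then 1 else if q = 3 then 1 else 0) = 1 → A 1 4 := by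
  intro p q hpq hpol hdg
  obtain ⟨a, b, hca, hcb, hdisj⟩ := threePair_member_classes δ0 h50 h41 h32 hvg p q 1 1 hpq
  rw [threePair_deg, threePair_deg] at hdg
  rcases hdisj with ⟨ha, hb⟩ | ⟨ha, hb⟩
  · rcases hca.2.1.mp ha with rfl | rfl
    · rcases hcb.2.1.mp hb with rfl | rfl
      · simp at hdg
      · exact hpol
    · rcases hcb.2.1.mp hb with rfl | rfl
      · exact hAs _ _ hpol
      · simp at hdg
  · rcases hca.2.1.mp ha with rfl | rfl
    · rcases hcb.2.1.mp hb with rfl | rfl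
      · simp at hdg
      · exact hpol
    · rcases hcb.2.1.mp hb with rfl | rfl
      · exact hAs _ _ hpol
      · simp at hdg

/-- Pure class `2δ₂`: a degree-2 member alive ⇒ the `t²`-slot `(3,3)` is alive. [this work] -/
theorem threePair_dict_P2_2 (δ0 : Fin 6 → ℝ) (h50 : δ0 5 = δ0 0) (h41 : δ0 4 = δ0 1) (h32 : δ0 3 = δ0 2)
    (hvg : ∀ a b c e : Fin 3, δ0 a.castSucc.castSucc.castSucc + δ0 b.castSucc.castSucc.castSucc
        = δ0 c.castSucc.castSucc.castSucc + δ0 e.castSucc.castSucc.castSucc → (a = c ∧ b = e) ∨ (a = e ∧ b = c))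
    (A : Fin 6 → Fin 6 → Prop) (_hAs : ∀ p q, A p q → A q p) :
    ∀ p q : Fin 6, δ0 p + δ0 q = δ0 2 + δ0 2 → A p q →
      (if p = 5 then 1 else if p = 4 then 1 else if p = 3 then 1 else 0) + (if q = 5 then 1 else if q = 4 then 1 else if q = 3 then 1 else 0) = 2 → A 3 3 := by
  intro p q hpq hpol hdg
  obtain ⟨a, b, hca, hcb, hdisj⟩ := threePair_member_classes δ0 h50 h41 h32 hvg p q 2 2 hpq
  rw [threePair_deg, threePair_deg] at hdg
  rcases hdisj with ⟨ha, hb⟩ | ⟨ha, hb⟩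
  · rcases hca.2.2.mp ha with rfl | rfl
    · rcases hcb.2.2.mp hb with rfl | rfl
      · simp at hdg
      · simp at hdg
    · rcases hcb.2.2.mp hb with rfl | rfl
      · simp at hdg
      · exact hpol
  · rcases hca.2.2.mp ha with rfl | rfl
    · rcases hcb.2.2.mp hb with rfl | rfl
      · simp at hdg
      · simp at hdg
    · rcases hcb.2.2.mp hb with rfl | rfl
      · simp at hdg
      · exact hpol

/-- Pure class `2δ₂`: a degree-1 member alive ⇒ the `t`-slot `(2,3)` is alive. [this work] -/
theorem threePair_dict_P2_1 (δ0 : Fin 6 → ℝ) (h50 : δ0 5 = δ0 0) (h41 : δ0 4 = δ0 1) (h32 : δ0 3 = δ0 2)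
    (hvg : ∀ a b c e : Fin 3, δ0 a.castSucc.castSucc.castSucc + δ0 b.castSucc.castSucc.castSucc
        = δ0 c.castSucc.castSucc.castSucc + δ0 e.castSucc.castSucc.castSucc → (a = c ∧ b = e) ∨ (a = e ∧ b = c))
    (A : Fin 6 → Fin 6 → Prop) (hAs : ∀ p q, A p q → A q p) :
    ∀ p q : Fin 6, δ0 p + δ0 q = δ0 2 + δ0 2 → A p q →
      (if p = 5 then 1 else if p = 4 then 1 else if p = 3 then 1 else 0) + (if q = 5 then 1 else if q = 4 then 1 else if q = 3 then 1 else 0) = 1 → A 2 3 := by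
  intro p q hpq hpol hdg
  obtain ⟨a, b, hca, hcb, hdisj⟩ := threePair_member_classes δ0 h50 h41 h32 hvg p q 2 2 hpq
  rw [threePair_deg, threePair_deg] at hdg
  rcases hdisj with ⟨ha, hb⟩ | ⟨ha, hb⟩
  · rcases hca.2.2.mp ha with rfl | rfl
    · rcases hcb.2.2.mp hb with rfl | rfl
      · simp at hdg
      · exact hpol
    · rcases hcb.2.2.mp hb with rfl | rfl
      · exact hAs _ _ hpol
      · simp at hdg
  · rcases hca.2.2.mp ha with rfl | rfl
    · rcases hcb.2.2.mp hb with rfl | rfl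
      · simp at hdg
      · exact hpol
    · rcases hcb.2.2.mp hb with rfl | rfl
      · exact hAs _ _ hpol
      · simp at hdg

/-- Mixed class `δ₀+δ₁`: a degree-2 member alive ⇒ the `t²`-slot `(5,4)` is alive. [this work] -/
theorem threePair_dict_M01_2 (δ0 : Fin 6 → ℝ) (h50 : δ0 5 = δ0 0) (h41 : δ0 4 = δ0 1) (h32 : δ0 3 = δ0 2)
    (hvg : ∀ a b c e : Fin 3, δ0 a.castSucc.castSucc.castSucc + δ0 b.castSucc.castSucc.castSucc
        = δ0 c.castSucc.castSucc.castSucc + δ0 e.castSucc.castSucc.castSucc → (a = c ∧ b = e) ∨ (a = e ∧ b = c))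
    (A : Fin 6 → Fin 6 → Prop) (hAs : ∀ p q, A p q → A q p) :
    ∀ p q : Fin 6, δ0 p + δ0 q = δ0 0 + δ0 1 → A p q →
      (if p = 5 then 1 else if p = 4 then 1 else if p = 3 then 1 else 0) + (if q = 5 then 1 else if q = 4 then 1 else if q = 3 then 1 else 0) = 2 → A 5 4 := by
  intro p q hpq hpol hdg
  obtain ⟨a, b, hca, hcb, hdisj⟩ := threePair_member_classes δ0 h50 h41 h32 hvg p q 0 1 hpq
  rw [threePair_deg, threePair_deg] at hdg
  rcases hdisj with ⟨ha, hb⟩ | ⟨ha, hb⟩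
  · rcases hca.1.mp ha with rfl | rfl
    · rcases hcb.2.1.mp hb with rfl | rfl
      · simp at hdg
      · simp at hdg
    · rcases hcb.2.1.mp hb with rfl | rfl
      · simp at hdg
      · exact hpol
  · rcases hca.2.1.mp ha with rfl | rfl
    · rcases hcb.1.mp hb with rfl | rfl
      · simp at hdg
      · simp at hdg
    · rcases hcb.1.mp hb with rfl | rfl
      · simp at hdg
      · exact hAs _ _ hpol

/-- Mixed class `δ₀+δ₁`: a degree-1 member alive ⇒ one of the `t`-slots `(0,4)`, `(5,1)` is alive. [this work] -/
theorem threePair_dict_M01_1 (δ0 : Fin 6 → ℝ) (h50 : δ0 5 = δ0 0) (h41 : δ0 4 = δ0 1) (h32 : δ0 3 = δ0 2)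
    (hvg : ∀ a b c e : Fin 3, δ0 a.castSucc.castSucc.castSucc + δ0 b.castSucc.castSucc.castSucc
        = δ0 c.castSucc.castSucc.castSucc + δ0 e.castSucc.castSucc.castSucc → (a = c ∧ b = e) ∨ (a = e ∧ b = c))
    (A : Fin 6 → Fin 6 → Prop) (hAs : ∀ p q, A p q → A q p) :
    ∀ p q : Fin 6, δ0 p + δ0 q = δ0 0 + δ0 1 → A p q →
      (if p = 5 then 1 else if p = 4 then 1 else if p = 3 then 1 else 0) + (if q = 5 then 1 else if q = 4 then 1 else if q = 3 then 1 else 0) = 1 → A 0 4 ∨ A 5 1 := by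
  intro p q hpq hpol hdg
  obtain ⟨a, b, hca, hcb, hdisj⟩ := threePair_member_classes δ0 h50 h41 h32 hvg p q 0 1 hpq
  rw [threePair_deg, threePair_deg] at hdg
  rcases hdisj with ⟨ha, hb⟩ | ⟨ha, hb⟩
  · rcases hca.1.mp ha with rfl | rfl
    · rcases hcb.2.1.mp hb with rfl | rfl
      · simp at hdg
      · exact Or.inl hpol
    · rcases hcb.2.1.mp hb with rfl | rfl
      · exact Or.inr hpol
      · simp at hdg
  · rcases hca.2.1.mp ha with rfl | rfl
    · rcases hcb.1.mp hb with rfl | rfl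
      · simp at hdg
      · exact Or.inr (hAs _ _ hpol)
    · rcases hcb.1.mp hb with rfl | rfl
      · exact Or.inl (hAs _ _ hpol)
      · simp at hdg

/-- Mixed class `δ₀+δ₂`: a degree-2 member alive ⇒ the `t²`-slot `(5,3)` is alive. [this work] -/
theorem threePair_dict_M02_2 (δ0 : Fin 6 → ℝ) (h50 : δ0 5 = δ0 0) (h41 : δ0 4 = δ0 1) (h32 : δ0 3 = δ0 2)
    (hvg : ∀ a b c e : Fin 3, δ0 a.castSucc.castSucc.castSucc + δ0 b.castSucc.castSucc.castSucc
        = δ0 c.castSucc.castSucc.castSucc + δ0 e.castSucc.castSucc.castSucc → (a = c ∧ b = e) ∨ (a = e ∧ b = c))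
    (A : Fin 6 → Fin 6 → Prop) (hAs : ∀ p q, A p q → A q p) :
    ∀ p q : Fin 6, δ0 p + δ0 q = δ0 0 + δ0 2 → A p q →
      (if p = 5 then 1 else if p = 4 then 1 else if p = 3 then 1 else 0) + (if q = 5 then 1 else if q = 4 then 1 else if q = 3 then 1 else 0) = 2 → A 5 3 := by
  intro p q hpq hpol hdg
  obtain ⟨a, b, hca, hcb, hdisj⟩ := threePair_member_classes δ0 h50 h41 h32 hvg p q 0 2 hpq
  rw [threePair_deg, threePair_deg] at hdg
  rcases hdisj with ⟨ha, hb⟩ | ⟨ha, hb⟩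
  · rcases hca.1.mp ha with rfl | rfl
    · rcases hcb.2.2.mp hb with rfl | rfl
      · simp at hdg
      · simp at hdg
    · rcases hcb.2.2.mp hb with rfl | rfl
      · simp at hdg
      · exact hpol
  · rcases hca.2.2.mp ha with rfl | rfl
    · rcases hcb.1.mp hb with rfl | rfl
      · simp at hdg
      · simp at hdg
    · rcases hcb.1.mp hb with rfl | rfl
      · simp at hdg
      · exact hAs _ _ hpol

/-- Mixed class `δ₀+δ₂`: a degree-1 member alive ⇒ one of the `t`-slots `(0,3)`, `(5,2)` is alive. [this work] -/
theorem threePair_dict_M02_1 (δ0 : Fin 6 → ℝ) (h50 : δ0 5 = δ0 0) (h41 : δ0 4 = δ0 1) (h32 : δ0 3 = δ0 2)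
    (hvg : ∀ a b c e : Fin 3, δ0 a.castSucc.castSucc.castSucc + δ0 b.castSucc.castSucc.castSucc
        = δ0 c.castSucc.castSucc.castSucc + δ0 e.castSucc.castSucc.castSucc → (a = c ∧ b = e) ∨ (a = e ∧ b = c))
    (A : Fin 6 → Fin 6 → Prop) (hAs : ∀ p q, A p q → A q p) :
    ∀ p q : Fin 6, δ0 p + δ0 q = δ0 0 + δ0 2 → A p q →
      (if p = 5 then 1 else if p = 4 then 1 else if p = 3 then 1 else 0) + (if q = 5 then 1 else if q = 4 then 1 else if q = 3 then 1 else 0) = 1 → A 0 3 ∨ A 5 2 := by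
  intro p q hpq hpol hdg
  obtain ⟨a, b, hca, hcb, hdisj⟩ := threePair_member_classes δ0 h50 h41 h32 hvg p q 0 2 hpq
  rw [threePair_deg, threePair_deg] at hdg
  rcases hdisj with ⟨ha, hb⟩ | ⟨ha, hb⟩
  · rcases hca.1.mp ha with rfl | rfl
    · rcases hcb.2.2.mp hb with rfl | rfl
      · simp at hdg
      · exact Or.inl hpol
    · rcases hcb.2.2.mp hb with rfl | rfl
      · exact Or.inr hpol
      · simp at hdg
  · rcases hca.2.2.mp ha with rfl | rfl
    · rcases hcb.1.mp hb with rfl | rfl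
      · simp at hdg
      · exact Or.inr (hAs _ _ hpol)
    · rcases hcb.1.mp hb with rfl | rfl
      · exact Or.inl (hAs _ _ hpol)
      · simp at hdg

/-- Mixed class `δ₁+δ₂`: a degree-2 member alive ⇒ the `t²`-slot `(4,3)` is alive. [this work] -/
theorem threePair_dict_M12_2 (δ0 : Fin 6 → ℝ) (h50 : δ0 5 = δ0 0) (h41 : δ0 4 = δ0 1) (h32 : δ0 3 = δ0 2)
    (hvg : ∀ a b c e : Fin 3, δ0 a.castSucc.castSucc.castSucc + δ0 b.castSucc.castSucc.castSucc
        = δ0 c.castSucc.castSucc.castSucc + δ0 e.castSucc.castSucc.castSucc → (a = c ∧ b = e) ∨ (a = e ∧ b = c))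
    (A : Fin 6 → Fin 6 → Prop) (hAs : ∀ p q, A p q → A q p) :
    ∀ p q : Fin 6, δ0 p + δ0 q = δ0 1 + δ0 2 → A p q →
      (if p = 5 then 1 else if p = 4 then 1 else if p = 3 then 1 else 0) + (if q = 5 then 1 else if q = 4 then 1 else if q = 3 then 1 else 0) = 2 → A 4 3 := by
  intro p q hpq hpol hdg
  obtain ⟨a, b, hca, hcb, hdisj⟩ := threePair_member_classes δ0 h50 h41 h32 hvg p q 1 2 hpq
  rw [threePair_deg, threePair_deg] at hdg
  rcases hdisj with ⟨ha, hb⟩ | ⟨ha, hb⟩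
  · rcases hca.2.1.mp ha with rfl | rfl
    · rcases hcb.2.2.mp hb with rfl | rfl
      · simp at hdg
      · simp at hdg
    · rcases hcb.2.2.mp hb with rfl | rfl
      · simp at hdg
      · exact hpol
  · rcases hca.2.2.mp ha with rfl | rfl
    · rcases hcb.2.1.mp hb with rfl | rfl
      · simp at hdg
      · simp at hdg
    · rcases hcb.2.1.mp hb with rfl | rfl
      · simp at hdg
      · exact hAs _ _ hpol

/-- Mixed class `δ₁+δ₂`: a degree-1 member alive ⇒ one of the `t`-slots `(1,3)`, `(4,2)` is alive. [this work] -/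
theorem threePair_dict_M12_1 (δ0 : Fin 6 → ℝ) (h50 : δ0 5 = δ0 0) (h41 : δ0 4 = δ0 1) (h32 : δ0 3 = δ0 2)
    (hvg : ∀ a b c e : Fin 3, δ0 a.castSucc.castSucc.castSucc + δ0 b.castSucc.castSucc.castSucc
        = δ0 c.castSucc.castSucc.castSucc + δ0 e.castSucc.castSucc.castSucc → (a = c ∧ b = e) ∨ (a = e ∧ b = c))
    (A : Fin 6 → Fin 6 → Prop) (hAs : ∀ p q, A p q → A q p) :
    ∀ p q : Fin 6, δ0 p + δ0 q = δ0 1 + δ0 2 → A p q →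
      (if p = 5 then 1 else if p = 4 then 1 else if p = 3 then 1 else 0) + (if q = 5 then 1 else if q = 4 then 1 else if q = 3 then 1 else 0) = 1 → A 1 3 ∨ A 4 2 := by
  intro p q hpq hpol hdg
  obtain ⟨a, b, hca, hcb, hdisj⟩ := threePair_member_classes δ0 h50 h41 h32 hvg p q 1 2 hpq
  rw [threePair_deg, threePair_deg] at hdg
  rcases hdisj with ⟨ha, hb⟩ | ⟨ha, hb⟩
  · rcases hca.2.1.mp ha with rfl | rfl
    · rcases hcb.2.2.mp hb with rfl | rfl
      · simp at hdg
      · exact Or.inl hpol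
    · rcases hcb.2.2.mp hb with rfl | rfl
      · exact Or.inr hpol
      · simp at hdg
  · rcases hca.2.2.mp ha with rfl | rfl
    · rcases hcb.2.1.mp hb with rfl | rfl
      · simp at hdg
      · exact Or.inr (hAs _ _ hpol)
    · rcases hcb.2.1.mp hb with rfl | rfl
      · exact Or.inl (hAs _ _ hpol)
      · simp at hdg

/-- The six class values at a three-Weyl-pair point: every pair sum `δ0 p + δ0 q` is one of `2δ₀, 2δ₁, 2δ₂, δ₀+δ₁, δ₀+δ₂, δ₁+δ₂`. [this work] -/
theorem threePair_values (δ0 : Fin 6 → ℝ) (h50 : δ0 5 = δ0 0) (h41 : δ0 4 = δ0 1) (h32 : δ0 3 = δ0 2) :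
    ∀ p q : Fin 6, δ0 p + δ0 q = δ0 0 + δ0 0 ∨ δ0 p + δ0 q = δ0 1 + δ0 1 ∨ δ0 p + δ0 q = δ0 2 + δ0 2 ∨
      δ0 p + δ0 q = δ0 0 + δ0 1 ∨ δ0 p + δ0 q = δ0 0 + δ0 2 ∨ δ0 p + δ0 q = δ0 1 + δ0 2 := by
  intro p q
  obtain ⟨a, ha, -⟩ := threePair_classes δ0 h50 h41 h32 p
  obtain ⟨b, hb, -⟩ := threePair_classes δ0 h50 h41 h32 q
  rw [ha, hb]
  fin_cases a <;> fin_cases b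
  exacts [Or.inl rfl, Or.inr (Or.inr (Or.inr (Or.inl rfl))), Or.inr (Or.inr (Or.inr (Or.inr (Or.inl rfl)))),
    Or.inr (Or.inr (Or.inr (Or.inl (add_comm _ _)))), Or.inr (Or.inl rfl), Or.inr (Or.inr (Or.inr (Or.inr (Or.inr rfl)))),
    Or.inr (Or.inr (Or.inr (Or.inr (Or.inl (add_comm _ _))))), Or.inr (Or.inr (Or.inr (Or.inr (Or.inr (add_comm _ _))))),
    Or.inr (Or.inr (Or.inl rfl))]

end Summit.ValiantsHypothesis.ValiantsHypothesis.Theorems.LacunarySymmetroidMatrixDescartes.WallBubbling
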